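import Literature.Analysis.ODE.CompactSupportFlow
import Literature.Analysis.Calculus.LocalInverseOnCompact
import Mathlib.Analysis.Normed.Operator.BoundedLinearMaps
import Mathlib.LinearAlgebra.FiniteDimensional.Lemmas
import Mathlib.Topology.Algebra.Module.FiniteDimension
import HarnessLib

/-!
# The flow-out chart of a transversal along a compact set (flow box along a compact set)

General differential topology (topic `Geometry/Manifold`, next to `FlowBox.lean`, which is the flow
box near ONE point), proofs plus one explicit definition.  Let `g` be a complete (globally
Lipschitz, bounded, `C^n`, `n ≥ 1`) vector field on a Banach space `G` with global flow `Fl`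
(`Literature/Analysis/ODE/CompactSupportFlow.lean`), and let `P : F → G` be a `C^n`
parametrisation of a "transversal".  The **flow-out map**

  `flowOut P (σ, r) = Fl_r (P σ)`

is `C^n` (`contDiff_flowOut`), restricts to `P` at `r = 0`, turns `r`-translation into the flow
(`flowOut_add`), has `∂_r flowOut = g ∘ flowOut` (`hasDerivAt_flowOut`), and at `r = 0` its
derivative is `(v, t) ↦ DP_σ v + t • g (P σ)` (`fderiv_flowOut_zero`).  Hence (**the flow box
along a compact set**, `exists_flowOutChart`): if `P` is injective on a compact set `C` and
`(v, t) ↦ DP_σ v + t • g(P σ)` is a linear isomorphism for `σ ∈ C` (transversality), then `flowOut P`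
restricts to a `C^n` diffeomorphism `e` from an open neighbourhood of `C × {0}` in `F × ℝ` onto an
open neighbourhood of `P '' C` in `G` — by the inverse function theorem globalised along a compact
set (`Literature/Analysis/Calculus/LocalInverseOnCompact.lean`).  In this chart the field is
`∂_r`: `D(e⁻¹)_q (g q) = (0, 1)` (`fderiv_flowOutChart_symm_apply_field`), so for any function
`u(σ, r)` one has `d(u ∘ e⁻¹)(g) = ∂_r u` (`fderiv_comp_flowOutChart_symm_apply_field`); in
particular functions of `σ` alone are first integrals and the `r`-coordinate has unit derivative
along `g`.  This is Lee, *Introduction to Smooth Manifolds* (2012), Thm. 9.22 (flow box) combined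
with Thm. 9.20 (flow-out theorem) in the flat Banach setting; the use (seat of
`Literature.Geometry.Symplectic.palf_stein_supportedByBoundaryOpenBook`) is the re-fibration of an
open book near an almost-horizontal curve, `θ' = θ − χ(σ) κ(r) e(σ)` in the flow box of the Reeb
field along the curve.  A finite-dimensional form of the transversality hypothesis is provided
(`exists_continuousLinearEquiv_of_injective`).

Everything is proved; one definition (`flowOut`, an explicit formula), no named fact.

## References

* J. M. Lee, *Introduction to Smooth Manifolds*, 2nd ed., GTM 218 (2012), Thms. 9.20, 9.22.
  [LeeSmoothManifolds2013]
* M. W. Hirsch, *Differential Topology*, GTM 33 (1976), Ch. 2 §1, Ex. 7 (injective local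
  diffeomorphism on a compact set). [Hirsch1976]
-/

open Set Function Filter Topology
open scoped NNReal

noncomputable section

namespace Literature.Geometry.Manifold

open Literature.Analysis.ODE Literature.Analysis.Calculus

variable {F : Type*} {G : Type*} [NormedAddCommGroup G] [NormedSpace ℝ G] [CompleteSpace G]
  {g : G → G} {K : ℝ≥0} {L : ℝ} {n : ℕ∞}

/-- `1 ≤ n` in `ℕ∞` gives `(n : WithTop ℕ∞) ≠ 0`. [folklore] -/
private theorem withTop_ne_zero_of_one_le (hn : 1 ≤ n) : ((n : ℕ∞) : WithTop ℕ∞) ≠ 0 := by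
  exact_mod_cast (zero_lt_one.trans_le hn).ne'

/-! ### The flow-out map -/

/-- **The flow-out map** of the parametrised transversal `P : F → G` along the complete field `g`:
`flowOut hK hL P (σ, r) = Fl_r (P σ)`. [cite: LeeSmoothManifolds2013, Thm. 9.20] -/
def flowOut (hK : LipschitzWith K g) (hL : ∀ q, ‖g q‖ ≤ L) (P : F → G) (p : F × ℝ) : G :=
  globalFlow hK hL (P p.1) p.2

/-- Unfolding. [folklore] -/
theorem flowOut_apply (hK : LipschitzWith K g) (hL : ∀ q, ‖g q‖ ≤ L) (P : F → G) (p : F × ℝ) :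
    flowOut hK hL P p = globalFlow hK hL (P p.1) p.2 := rfl

/-- At time `0` the flow-out map is the transversal. [folklore] -/
@[simp]
theorem flowOut_zero (hK : LipschitzWith K g) (hL : ∀ q, ‖g q‖ ≤ L) (P : F → G) (σ : F) :
    flowOut hK hL P (σ, 0) = P σ := by
  simp [flowOut]

/-- **`r`-translation is the flow**: `flowOut P (σ, r + r') = Fl_{r'} (flowOut P (σ, r))`.
[cite: LeeSmoothManifolds2013, Thm. 9.20] -/
theorem flowOut_add (hK : LipschitzWith K g) (hL : ∀ q, ‖g q‖ ≤ L) (P : F → G) (σ : F)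
    (r r' : ℝ) : flowOut hK hL P (σ, r + r') = globalFlow hK hL (flowOut hK hL P (σ, r)) r' := by
  simp [flowOut, globalFlow_add]

/-- `∂_r flowOut = g ∘ flowOut`: the `r`-lines are integral curves. [folklore] -/
theorem hasDerivAt_flowOut (hK : LipschitzWith K g) (hL : ∀ q, ‖g q‖ ≤ L) (P : F → G) (σ : F)
    (r : ℝ) : HasDerivAt (fun r => flowOut hK hL P (σ, r)) (g (flowOut hK hL P (σ, r))) r :=
  hasDerivAt_globalFlow hK hL (P σ) r

/-- **The derivative of the global flow at time `0`**: `D Fl_{(y, 0)} (w, t) = w + t • g y`.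
[folklore] -/
theorem fderiv_globalFlow_zero (hK : LipschitzWith K g) (hL : ∀ q, ‖g q‖ ≤ L)
    (hg : ContDiff ℝ n g) (hn : 1 ≤ n) (y w : G) (t : ℝ) :
    fderiv ℝ (fun q : G × ℝ => globalFlow hK hL q.1 q.2) (y, 0) (w, t) = w + t • g y := by
  set Ψ : G × ℝ → G := fun q => globalFlow hK hL q.1 q.2 with hΨ
  have hd : DifferentiableAt ℝ Ψ (y, 0) :=
    ((contDiff_globalFlow hg hn hK hL).differentiable (withTop_ne_zero_of_one_le hn)) _
  -- partial derivative in the space direction: `Ψ (·, 0) = id`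
  have h1 : (fderiv ℝ Ψ (y, 0)).comp (ContinuousLinearMap.inl ℝ G ℝ) = ContinuousLinearMap.id ℝ G := by
    have hc : HasFDerivAt (Ψ ∘ fun w : G => (w, (0 : ℝ)))
        ((fderiv ℝ Ψ (y, 0)).comp (ContinuousLinearMap.inl ℝ G ℝ)) y :=
      hd.hasFDerivAt.comp y (hasFDerivAt_prodMk_left y (0 : ℝ))
    have hid : HasFDerivAt (Ψ ∘ fun w : G => (w, (0 : ℝ))) (ContinuousLinearMap.id ℝ G) y := by
      have : (Ψ ∘ fun w : G => (w, (0 : ℝ))) = id := by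
        funext w
        simp [hΨ]
      rw [this]
      exact hasFDerivAt_id y
    exact hc.unique hid
  -- partial derivative in the time direction: the flow curve
  have h2 : (fderiv ℝ Ψ (y, 0)).comp (ContinuousLinearMap.inr ℝ G ℝ) =
      (ContinuousLinearMap.id ℝ ℝ).smulRight (g y) := by
    have hc : HasFDerivAt (Ψ ∘ fun s : ℝ => ((y, s) : G × ℝ))
        ((fderiv ℝ Ψ (y, 0)).comp (ContinuousLinearMap.inr ℝ G ℝ)) 0 :=
      hd.hasFDerivAt.comp (0 : ℝ) (hasFDerivAt_prodMk_right y (0 : ℝ))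
    have hfl : HasFDerivAt (Ψ ∘ fun s : ℝ => ((y, s) : G × ℝ))
        ((ContinuousLinearMap.id ℝ ℝ).smulRight (g y)) 0 := by
      have h := (hasDerivAt_globalFlow hK hL y 0).hasFDerivAt
      simp only [globalFlow_zero] at h
      exact h
    exact hc.unique hfl
  have hsplit : ((w, t) : G × ℝ) = ContinuousLinearMap.inl ℝ G ℝ w + ContinuousLinearMap.inr ℝ G ℝ t := by
    simp
  rw [hsplit, map_add, ← ContinuousLinearMap.comp_apply, ← ContinuousLinearMap.comp_apply, h1, h2]
  simp

section Smooth

variable [NormedAddCommGroup F] [NormedSpace ℝ F]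

/-- The flow-out map is `C^n` for a `C^n` field (`n ≥ 1`) and a `C^n` transversal. [folklore] -/
theorem contDiff_flowOut (hK : LipschitzWith K g) (hL : ∀ q, ‖g q‖ ≤ L) (hg : ContDiff ℝ n g)
    (hn : 1 ≤ n) {P : F → G} (hP : ContDiff ℝ n P) : ContDiff ℝ n (flowOut hK hL P) := by
  have h := (contDiff_globalFlow hg hn hK hL).comp (hP.prodMap contDiff_id)
  exact h

/-- **The derivative of the flow-out map on the transversal**:
`D(flowOut P)_{(σ, 0)} (v, t) = DP_σ v + t • g (P σ)`. [cite: LeeSmoothManifolds2013, Thm. 9.20] -/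
theorem fderiv_flowOut_zero (hK : LipschitzWith K g) (hL : ∀ q, ‖g q‖ ≤ L) (hg : ContDiff ℝ n g)
    (hn : 1 ≤ n) {P : F → G} (hP : ContDiff ℝ n P) (σ v : F) (t : ℝ) :
    fderiv ℝ (flowOut hK hL P) (σ, 0) (v, t) = fderiv ℝ P σ v + t • g (P σ) := by
  have hn0 := withTop_ne_zero_of_one_le hn
  have hΨd : DifferentiableAt ℝ (fun q : G × ℝ => globalFlow hK hL q.1 q.2) (P σ, 0) :=
    ((contDiff_globalFlow hg hn hK hL).differentiable hn0) _
  have hPm : HasFDerivAt (Prod.map P (id : ℝ → ℝ))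
      ((fderiv ℝ P σ).prodMap (ContinuousLinearMap.id ℝ ℝ)) (σ, (0 : ℝ)) :=
    HasFDerivAt.prodMap ((σ, (0 : ℝ)) : F × ℝ) ((hP.differentiable hn0) σ).hasFDerivAt
      (hasFDerivAt_id (0 : ℝ))
  have hcomp : HasFDerivAt (flowOut hK hL P)
      ((fderiv ℝ (fun q : G × ℝ => globalFlow hK hL q.1 q.2) (P σ, 0)).comp
        ((fderiv ℝ P σ).prodMap (ContinuousLinearMap.id ℝ ℝ))) (σ, 0) := by
    have h := hΨd.hasFDerivAt.comp ((σ, (0 : ℝ)) : F × ℝ) hPm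
    exact h
  rw [hcomp.fderiv, ContinuousLinearMap.comp_apply]
  simp only [ContinuousLinearMap.coe_prodMap', Prod.map_apply, ContinuousLinearMap.id_apply]
  rw [fderiv_globalFlow_zero hK hL hg hn]

/-- Along `g` the flow-out map has derivative `g`: `D(flowOut P)_p (0, 1) = g (flowOut P p)`.
[folklore] -/
theorem fderiv_flowOut_apply_zero_one (hK : LipschitzWith K g) (hL : ∀ q, ‖g q‖ ≤ L)
    (hg : ContDiff ℝ n g) (hn : 1 ≤ n) {P : F → G} (hP : ContDiff ℝ n P) (p : F × ℝ) :
    fderiv ℝ (flowOut hK hL P) p (0, 1) = g (flowOut hK hL P p) := by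
  have hd : DifferentiableAt ℝ (flowOut hK hL P) p :=
    ((contDiff_flowOut hK hL hg hn hP).differentiable (withTop_ne_zero_of_one_le hn)) p
  have hc : HasFDerivAt (flowOut hK hL P ∘ fun s : ℝ => ((p.1, s) : F × ℝ))
      ((fderiv ℝ (flowOut hK hL P) p).comp (ContinuousLinearMap.inr ℝ F ℝ)) p.2 :=
    hd.hasFDerivAt.comp p.2 (hasFDerivAt_prodMk_right p.1 p.2)
  have hfl : HasFDerivAt (flowOut hK hL P ∘ fun s : ℝ => ((p.1, s) : F × ℝ))
      ((ContinuousLinearMap.id ℝ ℝ).smulRight (g (flowOut hK hL P p))) p.2 :=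
    (hasDerivAt_flowOut hK hL P p.1 p.2).hasFDerivAt
  have heq := hc.unique hfl
  have := congrArg (fun T : ℝ →L[ℝ] G => T 1) heq
  simpa using this

/-! ### The flow-out chart along a compact set -/

/-- **Flow box along a compact set (flow-out chart).**  Let `g` be a complete `C^n` field
(`n ≥ 1`) on the Banach space `G`, `P : F → G` a `C^n` map from a Banach space, `C ⊆ F` compact,
`P` injective on `C`, and suppose that for every `σ ∈ C` the map `(v, t) ↦ DP_σ v + t • g (P σ)`
is a continuous linear isomorphism `F × ℝ ≃ G` (the transversal is transverse to `g` and of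
complementary dimension).  Then the flow-out map restricts to a `C^n` diffeomorphism `e` of an open
neighbourhood of `C × {0}` onto an open subset of `G`: `⇑e = flowOut P`, `C × {0} ⊆ e.source`,
`e⁻¹` is `C^n` on `e.target`, and `D(flowOut P)` is invertible on `e.source`.
[cite: LeeSmoothManifolds2013, Thm. 9.22] -/
theorem exists_flowOutChart [CompleteSpace F] (hK : LipschitzWith K g) (hL : ∀ q, ‖g q‖ ≤ L)
    (hg : ContDiff ℝ n g) (hn : 1 ≤ n) {P : F → G} (hP : ContDiff ℝ n P) {C : Set F}
    (hC : IsCompact C) (hinj : InjOn P C)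
    (hinv : ∀ σ ∈ C, ∃ M : (F × ℝ) ≃L[ℝ] G, ∀ v t, M (v, t) = fderiv ℝ P σ v + t • g (P σ)) :
    ∃ e : OpenPartialHomeomorph (F × ℝ) G, ⇑e = flowOut hK hL P ∧ C ×ˢ {0} ⊆ e.source ∧
      ContDiffOn ℝ n e.symm e.target ∧
      ∀ p ∈ e.source, ∃ M : (F × ℝ) ≃L[ℝ] G, HasFDerivAt (flowOut hK hL P) (M : F × ℝ →L[ℝ] G) p := by
  have hn0 := withTop_ne_zero_of_one_le hn
  set Φ := flowOut hK hL P with hΦ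
  have hΦc : ContDiff ℝ n Φ := contDiff_flowOut hK hL hg hn hP
  have hΦd : Differentiable ℝ Φ := hΦc.differentiable hn0
  have hcont : Continuous fun p => fderiv ℝ Φ p := hΦc.continuous_fderiv hn0
  -- the open set where the derivative is invertible
  set U : Set (F × ℝ) := (fun p => fderiv ℝ Φ p) ⁻¹'
    range ((↑) : ((F × ℝ) ≃L[ℝ] G) → (F × ℝ) →L[ℝ] G) with hU
  have hUo : IsOpen U := ContinuousLinearEquiv.isOpen.preimage hcont
  have hU' : ∀ p ∈ U, ∃ M : (F × ℝ) ≃L[ℝ] G, HasFDerivAt Φ (M : F × ℝ →L[ℝ] G) p := by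
    rintro p ⟨M, hM⟩
    exact ⟨M, by rw [hM]; exact (hΦd p).hasFDerivAt⟩
  have hKU : C ×ˢ ({0} : Set ℝ) ⊆ U := by
    rintro ⟨σ, r⟩ ⟨hσ, hr⟩
    rw [mem_singleton_iff] at hr
    subst hr
    obtain ⟨M, hM⟩ := hinv σ hσ
    refine ⟨M, ?_⟩
    ext v <;> simp [hΦ, fderiv_flowOut_zero hK hL hg hn hP, hM]
  have hKc : IsCompact (C ×ˢ ({0} : Set ℝ)) := hC.prod isCompact_singleton
  have hinj' : InjOn Φ (C ×ˢ ({0} : Set ℝ)) := by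
    rintro ⟨σ, r⟩ ⟨hσ, hr⟩ ⟨σ', r'⟩ ⟨hσ', hr'⟩ h
    rw [mem_singleton_iff] at hr hr'
    subst hr hr'
    simp only [hΦ, flowOut_zero] at h
    exact Prod.ext (hinj hσ hσ' h) rfl
  obtain ⟨e, he, hKe, heU, hsymm⟩ := exists_openPartialHomeomorph_contDiffOn_symm (𝕂 := ℝ) hn0
    hUo hKU hKc hΦc.contDiffOn hU' hinj'
  exact ⟨e, he, hKe, hsymm, fun p hp => hU' p (heU hp)⟩

/-! ### The field in the flow-out chart -/

variable {P : F → G} {e : OpenPartialHomeomorph (F × ℝ) G}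

omit [NormedSpace ℝ F] in
/-- In the flow-out chart, the flow is `r`-translation: if `(σ, r)` and `(σ, r + r')` lie in the
source then `e⁻¹ (Fl_{r'} (e (σ, r))) = (σ, r + r')`. [cite: LeeSmoothManifolds2013, Thm. 9.22] -/
theorem flowOutChart_symm_globalFlow (hK : LipschitzWith K g) (hL : ∀ q, ‖g q‖ ≤ L)
    (he : ⇑e = flowOut hK hL P) {σ : F} {r r' : ℝ} (h2 : (σ, r + r') ∈ e.source) :
    e.symm (globalFlow hK hL (e (σ, r)) r') = (σ, r + r') := by
  have : globalFlow hK hL (e (σ, r)) r' = e (σ, r + r') := by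
    rw [he, flowOut_add]
  rw [this, e.left_inv h2]

omit [NormedSpace ℝ F] in
/-- The flow line through a point of the target stays, for small times, the image of the
`r`-translated chart point. [folklore] -/
theorem eventually_globalFlow_eq_flowOutChart (hK : LipschitzWith K g) (hL : ∀ q, ‖g q‖ ≤ L)
    (he : ⇑e = flowOut hK hL P) {q : G} (hq : q ∈ e.target) :
    ∀ᶠ r' in 𝓝 (0 : ℝ), ((e.symm q).1, (e.symm q).2 + r') ∈ e.source ∧
      globalFlow hK hL q r' = e ((e.symm q).1, (e.symm q).2 + r') := by
  have hsrc : e.symm q ∈ e.source := e.map_target hq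
  have hcont : Continuous fun r' : ℝ => (((e.symm q).1, (e.symm q).2 + r') : F × ℝ) := by
    fun_prop
  have hmem : ∀ᶠ r' in 𝓝 (0 : ℝ), (((e.symm q).1, (e.symm q).2 + r') : F × ℝ) ∈ e.source := by
    have h0 : (((e.symm q).1, (e.symm q).2 + 0) : F × ℝ) ∈ e.source := by simpa using hsrc
    exact hcont.continuousAt.eventually (e.open_source.mem_nhds h0)
  filter_upwards [hmem] with r' hr'
  refine ⟨hr', ?_⟩
  have h1 : e ((e.symm q).1, (e.symm q).2) = q := by
    rw [Prod.mk.eta, e.right_inv hq]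
  rw [he, flowOut_add, ← he, h1]

/-- **The field is `∂_r` in the flow-out chart**: `D(e⁻¹)_q (g q) = (0, 1)` for `q ∈ e.target`
(when `e⁻¹` is differentiable there, e.g. by `exists_flowOutChart`).
[cite: LeeSmoothManifolds2013, Thm. 9.22] -/
theorem fderiv_flowOutChart_symm_apply_field (hK : LipschitzWith K g) (hL : ∀ q, ‖g q‖ ≤ L)
    (he : ⇑e = flowOut hK hL P) {q : G} (hq : q ∈ e.target)
    (hd : DifferentiableAt ℝ e.symm q) : fderiv ℝ e.symm q (g q) = (0, 1) := by
  -- the curve `r' ↦ Fl_{r'} q` has velocity `g q` at `0` and `e⁻¹ ∘` it is `r' ↦ (σ, r + r')`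
  have hcurve : HasDerivAt (fun r' => globalFlow hK hL q r') (g q) 0 := by
    have h := hasDerivAt_globalFlow hK hL q 0
    simpa using h
  have hcomp : HasDerivAt (e.symm ∘ fun r' => globalFlow hK hL q r') (fderiv ℝ e.symm q (g q)) 0 :=
    hd.hasFDerivAt.comp_hasDerivAt_of_eq (0 : ℝ) hcurve (by simp)
  have hline : HasDerivAt (fun r' : ℝ => (((e.symm q).1, (e.symm q).2 + r') : F × ℝ))
      ((0 : F), (1 : ℝ)) 0 := by
    refine (hasDerivAt_const (0 : ℝ) (e.symm q).1).prodMk ?_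
    simpa using (hasDerivAt_id (0 : ℝ)).const_add (e.symm q).2
  have heq : (fun r' : ℝ => (((e.symm q).1, (e.symm q).2 + r') : F × ℝ)) =ᶠ[𝓝 0]
      (e.symm ∘ fun r' => globalFlow hK hL q r') := by
    filter_upwards [eventually_globalFlow_eq_flowOutChart hK hL he hq] with r' hr'
    rw [Function.comp_apply, hr'.2, e.left_inv hr'.1]
  exact (hcomp.congr_of_eventuallyEq heq).unique hline

/-- **Functions in the flow-out chart differentiate along `g` as `∂_r`**: for `u : F × ℝ → H`
differentiable at `e⁻¹ q`, `D(u ∘ e⁻¹)_q (g q) = Du_{e⁻¹ q} (0, 1)`.  In particular a function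
of `σ` alone is a first integral of `g`, and the `r`-coordinate has derivative `1` along `g`.
[cite: LeeSmoothManifolds2013, Thm. 9.22] -/
theorem fderiv_comp_flowOutChart_symm_apply_field {H : Type*} [NormedAddCommGroup H]
    [NormedSpace ℝ H] (hK : LipschitzWith K g) (hL : ∀ q, ‖g q‖ ≤ L)
    (he : ⇑e = flowOut hK hL P) {q : G} (hq : q ∈ e.target) (hd : DifferentiableAt ℝ e.symm q)
    {u : F × ℝ → H} (hu : DifferentiableAt ℝ u (e.symm q)) :
    fderiv ℝ (u ∘ e.symm) q (g q) = fderiv ℝ u (e.symm q) (0, 1) := by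
  rw [fderiv_comp q hu hd, ContinuousLinearMap.comp_apply,
    fderiv_flowOutChart_symm_apply_field hK hL he hq hd]

/-- The `σ`-coordinate is a first integral: `D(Prod.fst ∘ e⁻¹)_q (g q) = 0`. [folklore] -/
theorem fderiv_fst_flowOutChart_symm_apply_field (hK : LipschitzWith K g) (hL : ∀ q, ‖g q‖ ≤ L)
    (he : ⇑e = flowOut hK hL P) {q : G} (hq : q ∈ e.target) (hd : DifferentiableAt ℝ e.symm q) :
    fderiv ℝ (fun q => (e.symm q).1) q (g q) = 0 := by
  have h := fderiv_comp_flowOutChart_symm_apply_field hK hL he hq hd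
    (u := fun p : F × ℝ => p.1) differentiableAt_fst
  rw [show (fun q => (e.symm q).1) = (fun p : F × ℝ => p.1) ∘ e.symm from rfl, h, fderiv_fst]
  simp

/-- The `r`-coordinate has unit derivative along the field: `D(Prod.snd ∘ e⁻¹)_q (g q) = 1`.
[folklore] -/
theorem fderiv_snd_flowOutChart_symm_apply_field (hK : LipschitzWith K g) (hL : ∀ q, ‖g q‖ ≤ L)
    (he : ⇑e = flowOut hK hL P) {q : G} (hq : q ∈ e.target) (hd : DifferentiableAt ℝ e.symm q) :
    fderiv ℝ (fun q => (e.symm q).2) q (g q) = 1 := by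
  have h := fderiv_comp_flowOutChart_symm_apply_field hK hL he hq hd
    (u := fun p : F × ℝ => p.2) differentiableAt_snd
  rw [show (fun q => (e.symm q).2) = (fun p : F × ℝ => p.2) ∘ e.symm from rfl, h, fderiv_snd]
  simp

/-! ### The transversality hypothesis in finite dimensions -/

omit [CompleteSpace G] in
/-- In finite dimensions, transversality plus the dimension count give the isomorphism required by
`exists_flowOutChart`: if `dim F + 1 = dim G` and `(v, t) ↦ A v + t • w` is injective then it is
a continuous linear isomorphism `F × ℝ ≃ G`. [folklore] -/
theorem exists_continuousLinearEquiv_of_injective [FiniteDimensional ℝ F] [FiniteDimensional ℝ G]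
    (A : F →L[ℝ] G) (w : G) (hdim : Module.finrank ℝ F + 1 = Module.finrank ℝ G)
    (hinj : ∀ (v : F) (t : ℝ), A v + t • w = 0 → v = 0 ∧ t = 0) :
    ∃ M : (F × ℝ) ≃L[ℝ] G, ∀ v t, M (v, t) = A v + t • w := by
  set T : F × ℝ →ₗ[ℝ] G := (A : F →ₗ[ℝ] G).coprod ((LinearMap.id : ℝ →ₗ[ℝ] ℝ).smulRight w)
    with hT
  have hTapply : ∀ v t, T (v, t) = A v + t • w := fun v t => by
    simp [hT]
  have hTinj : Function.Injective T := by
    rw [← LinearMap.ker_eq_bot, LinearMap.ker_eq_bot']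
    rintro ⟨v, t⟩ h
    rw [hTapply] at h
    obtain ⟨hv, ht⟩ := hinj v t h
    simp [hv, ht]
  have hdim' : Module.finrank ℝ (F × ℝ) = Module.finrank ℝ G := by
    rw [Module.finrank_prod, Module.finrank_self, hdim]
  refine ⟨(T.linearEquivOfInjective hTinj hdim').toContinuousLinearEquiv, fun v t => ?_⟩
  simp [hTapply]

end Smooth

end Literature.Geometry.Manifold

end
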